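import Literature.NumberTheory.LFunctions.MultiplicativeAutomatic
import Mathlib.NumberTheory.Multiplicity
import Mathlib.Analysis.Complex.Basic
import Mathlib.FieldTheory.Finite.Basic
import Mathlib.Data.Nat.ChineseRemainder
import Mathlib.Data.Nat.Factorization.Basic
import HarnessLib

/-!
# Klurman–Kurlberg 2019, Theorem 1.3 — proofs (sparse half, reduction)

Proofs file accompanying `Literature/NumberTheory/LFunctions/MultiplicativeAutomatic.lean`.

## What is proved here

* `KlurmanKurlberg2019_prop24` — the SPARSE HALF of [KK, Thm 1.3] = [KK, Prop 2.4]: if a completely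
  multiplicative `q`-automatic `f : ℕ → ℂ` vanishes at infinitely many primes, then it vanishes at
  every prime not dividing `q` (in particular at every prime `p > q`). The paper proves this via
  Lemma 2.2 (CRT + the "pumping constant" `k₀`) and Lemma 2.3 = Heath-Brown's theorem on Artin's
  conjecture. Here Heath-Brown is replaced by an elementary counting argument (our own; the authors'
  later note [KK-II, Prop 2.7] gives a different combinatorial proof): with `S = {n : f n ≠ 0}`,
  (a) the pumping constant, (b) a lifting-the-exponent bound `q^i ∣ t^m - 1 → q^i ∣ C·m` for a
  prime `t ∤ q` in `S`, (c) hence `≫ q^i` elements of `S` below `(k₀+1)q^i`, (d) the residues of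
  `S` modulo a product `P` of "zero primes" form a multiplicatively closed set of units, so either
  every unit residue is hit or at most half of them are (a hand-made Lagrange argument), and missing
  residues for many disjoint blocks would make `S` too thin for (c); (e) a block of `k₀` zero
  primes all of whose unit residues are hit by `S` gives, by CRT, an `s ∈ S` with
  `p_n ∣ q^i n + s` for `n = 1, …, k₀`, so pumping kills the whole class of `s` mod `q^i`, which
  however contains `s · t^{φ(q^i)} ∈ S`.
* `KlurmanKurlberg2019_thm13_of_prop21` — the printed two-case assembly: Theorem 1.3 follows from
  the sparse half together with the DENSE HALF [KK, Prop 2.1] ("finitely many zero primes ⇒ `f`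
  is a Dirichlet character off them"), whose only known proofs use Elliott–Kish 2017, Thm 2
  (harmonic analysis on `ℚ_{>0}`); the dense half is taken as an explicit hypothesis, stated
  inline (it is NOT vendored as a named fact here).

## References

* [KK] O. Klurman, P. Kurlberg, *A note on multiplicative automatic sequences*, C. R. Math. 357
  (2019) 752–755, arXiv:1904.04337, §2. [KlurmanKurlberg2019]
* [KK-II] O. Klurman, P. Kurlberg, *A note on multiplicative automatic sequences, II*, Bull. LMS 52
  (2020), arXiv:1905.10897, Prop 2.7.
-/

namespace Literature.NumberTheory.LFunctions

open Finset

open scoped Classical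

/-! ### Basic consequences of complete multiplicativity -/

section Basics

variable {f : ℕ → ℂ}

/-- A completely multiplicative `f` with some nonzero value has `f 1 = 1`. [folklore] -/
theorem cm_map_one (hf : ∀ m n : ℕ, f (m * n) = f m * f n) {t : ℕ} (ht : f t ≠ 0) :
    f 1 = 1 := by
  have h := hf 1 t
  rw [one_mul] at h
  have h' : f 1 * f t = 1 * f t := by rw [← h, one_mul]
  exact mul_right_cancel₀ ht h'

/-- A completely multiplicative `f` with `f 1 = 1` satisfies `f (t ^ n) = f t ^ n`. [folklore] -/
theorem cm_map_pow (hf : ∀ m n : ℕ, f (m * n) = f m * f n) (h1 : f 1 = 1) (t n : ℕ) :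
    f (t ^ n) = f t ^ n := by
  induction n with
  | zero => simp [h1]
  | succ n ih => rw [pow_succ, hf, ih, pow_succ]

/-- A completely multiplicative `f` (on all of `ℕ`) with a zero has `f 0 = 0`. [folklore] -/
theorem cm_map_zero (hf : ∀ m n : ℕ, f (m * n) = f m * f n) {p : ℕ} (hp : f p = 0) :
    f 0 = 0 := by
  have h := hf 0 p
  rw [zero_mul] at h
  rw [h, hp, mul_zero]

/-- If `p ∣ x` and `f p = 0` then `f x = 0`, for completely multiplicative `f`. [folklore] -/
theorem cm_eq_zero_of_dvd (hf : ∀ m n : ℕ, f (m * n) = f m * f n) {p x : ℕ} (hp : f p = 0)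
    (hpx : p ∣ x) : f x = 0 := by
  obtain ⟨c, rfl⟩ := hpx
  rw [hf, hp, zero_mul]

/-- Nonvanishing is multiplicative: `f (m * n) ≠ 0` iff both factors are nonzero. [folklore] -/
theorem cm_mul_ne_zero (hf : ∀ m n : ℕ, f (m * n) = f m * f n) {m n : ℕ} (hm : f m ≠ 0)
    (hn : f n ≠ 0) : f (m * n) ≠ 0 := by
  rw [hf]; exact mul_ne_zero hm hn

end Basics

/-! ### (a) The pumping constant of a finite kernel -/

section Pumping

variable {q : ℕ} {f : ℕ → ℂ}

/-- **Pumping constant** ([KK, before Lemma 2.2]: "there exists `k₀ = k₀(f)` such that for all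
`i ≥ 1` and `0 ≤ r ≤ qⁱ - 1`, the equalities `f(qⁱn + r) = 0` for `n ∈ [1, k₀]` imply
`f(qⁱn + r) = 0` for all `n ≥ 1`"). Proof: the kernel is finite; take the maximum over its
elements of a witness of non-vanishing on `n ≥ 1`. [cite: KlurmanKurlberg2019, §2] -/
theorem exists_pumping_const (hA : IsAutomaticSeq q f) :
    ∃ k : ℕ, ∀ i : ℕ, 1 ≤ i → ∀ r : ℕ, r < q ^ i →
      (∀ n : ℕ, 1 ≤ n → n ≤ k → f (q ^ i * n + r) = 0) →
        ∀ n : ℕ, 1 ≤ n → f (q ^ i * n + r) = 0 := by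
  have hK : (qKernel q f).Finite := hA
  let w : (ℕ → ℂ) → ℕ := fun g => if h : ∃ n : ℕ, 1 ≤ n ∧ g n ≠ 0 then Nat.find h else 0
  refine ⟨hK.toFinset.sup w, ?_⟩
  intro i hi r hr hzero n hn
  by_contra hne
  set g : ℕ → ℂ := fun n => f (q ^ i * n + r) with hg
  have hmem : g ∈ qKernel q f := ⟨i, hi, r, hr, rfl⟩
  have hex : ∃ n : ℕ, 1 ≤ n ∧ g n ≠ 0 := ⟨n, hn, hne⟩
  have hw : w g = Nat.find hex := dif_pos hex
  have hspec := Nat.find_spec hex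
  have hle : w g ≤ hK.toFinset.sup w :=
    Finset.le_sup (f := w) ((Set.Finite.mem_toFinset hK).mpr hmem)
  exact hspec.2 (hzero (Nat.find hex) hspec.1 (hw ▸ hle))

end Pumping

/-! ### (b) A lifting-the-exponent bound on the order of `t` modulo `qⁱ` -/

section OrderBound

/-- Monotonicity of `padicValNat` under divisibility. [folklore] -/
theorem padicValNat_le_of_dvd' {p a b : ℕ} (hp : p.Prime) (hb : b ≠ 0) (h : a ∣ b) :
    padicValNat p a ≤ padicValNat p b := by
  rcases eq_or_ne a 0 with rfl | ha
  · exact absurd (zero_dvd_iff.mp h) hb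
  have := (Nat.factorization_le_iff_dvd ha hb).mpr h p
  simpa [Nat.factorization_def _ hp] using this

/-- **Order bound.** For `t ≥ 2` coprime to `q ≥ 1` there is `C > 0` with
`qⁱ ∣ tᵐ - 1 → qⁱ ∣ C·m` for all `i` and `m ≥ 1`; equivalently the multiplicative order of `t`
modulo `qⁱ` is at least `qⁱ/C`. Here `C = t^{2φ(q)} - 1`; the proof is the lifting-the-exponent
lemma prime by prime (`padicValNat.pow_sub_pow`, `padicValNat.pow_two_sub_one`). [folklore] -/
theorem exists_dvd_mul_of_pow_dvd_pow_sub_one {q t : ℕ} (hq : 1 ≤ q) (ht : 2 ≤ t)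
    (htq : Nat.Coprime t q) :
    ∃ C : ℕ, 0 < C ∧ ∀ i m : ℕ, 1 ≤ m → q ^ i ∣ t ^ m - 1 → q ^ i ∣ C * m := by
  set d : ℕ := Nat.totient q with hd
  have hd1 : 1 ≤ d := Nat.totient_pos.mpr (by omega)
  set X : ℕ := t ^ d with hX
  have hqX : q ∣ X - 1 := by
    have h := Nat.ModEq.pow_totient htq
    exact (Nat.modEq_iff_dvd' (Nat.one_le_pow _ _ (by omega))).mp h.symm
  have htX : t ≤ X := by
    rw [hX]; exact Nat.le_self_pow (by omega) t
  have hX1 : 1 < X := by omega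
  -- write X = Y + 1 to expand X² - 1 = (X + 1)(X - 1)
  have hsq : X ^ 2 - 1 = (X + 1) * (X - 1) := by
    obtain ⟨Y, hY⟩ : ∃ Y, X = Y + 1 := ⟨X - 1, by omega⟩
    rw [hY, Nat.add_sub_cancel]
    have : (Y + 1) ^ 2 = (Y + 1 + 1) * Y + 1 := by ring
    rw [this, Nat.add_sub_cancel]
  have hC0 : 0 < X ^ 2 - 1 := by
    rw [hsq]; exact Nat.mul_pos (by omega) (by omega)
  refine ⟨X ^ 2 - 1, hC0, ?_⟩
  intro i m hm hdiv
  have htm1 : 2 ≤ t ^ m := le_trans ht (Nat.le_self_pow (by omega) t)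
  have htm : t ^ m - 1 ≠ 0 := by omega
  have hqi : q ^ i ≠ 0 := pow_ne_zero _ (by omega)
  have hCm : (X ^ 2 - 1) * m ≠ 0 := Nat.mul_ne_zero hC0.ne' (by omega)
  have hchain : t ^ m - 1 ∣ X ^ (2 * m) - 1 := by
    rw [hX, ← pow_mul]
    exact Nat.pow_sub_one_dvd_pow_sub_one t (Dvd.intro (d * 2) (by ring))
  have hX2m1 : 2 ≤ X ^ (2 * m) := le_trans (by omega) (Nat.le_self_pow (by omega) X)
  have hX2m : X ^ (2 * m) - 1 ≠ 0 := by omega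
  rw [← Nat.factorization_prime_le_iff_dvd hqi hCm]
  intro p hp
  by_cases hpq : p ∣ q
  · have h1 : (q ^ i).factorization p ≤ (t ^ m - 1).factorization p :=
      (Nat.factorization_le_iff_dvd hqi htm).mpr hdiv p
    have h2 : (t ^ m - 1).factorization p ≤ (X ^ (2 * m) - 1).factorization p :=
      (Nat.factorization_le_iff_dvd htm hX2m).mpr hchain p
    have h3 : (X ^ (2 * m) - 1).factorization p ≤ ((X ^ 2 - 1) * m).factorization p := by
      rw [Nat.factorization_mul hC0.ne' (by omega), Finsupp.add_apply]
      simp only [Nat.factorization_def _ hp]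
      have hpX : ¬ p ∣ X := fun h => by
        have h' : p ∣ t := hp.dvd_of_dvd_pow h
        have : p ∣ Nat.gcd t q := Nat.dvd_gcd h' hpq
        rw [Nat.Coprime.gcd_eq_one htq] at this
        exact hp.one_lt.ne' (Nat.dvd_one.mp this)
      haveI := Fact.mk hp
      rcases hp.eq_two_or_odd' with rfl | hodd
      · -- p = 2
        have key := padicValNat.pow_two_sub_one (x := X) (n := 2 * m) hX1 hpX (by omega) ⟨m, by ring⟩
        have hv2m : padicValNat 2 (2 * m) = 1 + padicValNat 2 m := by
          rw [padicValNat.mul (by norm_num) (by omega), padicValNat_self]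
        have hvsq : padicValNat 2 (X ^ 2 - 1) = padicValNat 2 (X + 1) + padicValNat 2 (X - 1) := by
          rw [hsq, padicValNat.mul (by omega) (by omega)]
        omega
      · -- odd p
        have hpX1 : p ∣ X - 1 := dvd_trans hpq hqX
        have key := padicValNat.pow_sub_pow (p := p) (x := X) (y := 1) hodd hX1
          (by simpa using hpX1) hpX (n := 2 * m) (by omega)
        rw [one_pow] at key
        have hp2 : ¬ p ∣ 2 := by
          intro h
          have : p ≤ 2 := Nat.le_of_dvd (by norm_num) h
          have : 2 ≤ p := hp.two_le
          have hp2 : p = 2 := by omega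
          exact (Nat.not_even_iff_odd.mpr hodd) (hp2 ▸ even_two)
        have hv2m : padicValNat p (2 * m) = padicValNat p m := by
          rw [padicValNat.mul (by norm_num) (by omega), padicValNat.eq_zero_of_not_dvd hp2, zero_add]
        have hle : padicValNat p (X - 1) ≤ padicValNat p (X ^ 2 - 1) :=
          padicValNat_le_of_dvd' hp hC0.ne' (by rw [hsq]; exact Dvd.intro_left _ rfl)
        omega
    exact h1.trans (h2.trans h3)
  · have : (q ^ i).factorization p = 0 := by
      rw [Nat.factorization_pow]
      simp [Nat.factorization_eq_zero_of_not_dvd hpq]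
    rw [this]; exact Nat.zero_le _

end OrderBound

/-! ### (c) Many nonzero values below `(k+1)·qⁱ` -/

section ManyNonzero

variable {q : ℕ} {f : ℕ → ℂ}

/-- If `t` is a prime-to-`q` element with `f t ≠ 0`, then every residue class `tʲ mod qⁱ`
contains elements of `S = {f ≠ 0}` beyond its least element, so by the pumping constant it
contains one among the first `k` shifts; the residues `tʲ mod qⁱ`, `j < qⁱ/C`, being distinct
by the order bound, this yields `qⁱ/C ≤ #(S ∩ [0,(k+1)qⁱ))`. [folklore] -/
theorem card_nonzero_ge (hq : 2 ≤ q) (hf : ∀ m n : ℕ, f (m * n) = f m * f n) (h1 : f 1 = 1)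
    {t : ℕ} (ht : 2 ≤ t) (htq : Nat.Coprime t q) (hft : f t ≠ 0)
    {C : ℕ} (hC : 0 < C) (hord : ∀ i m : ℕ, 1 ≤ m → q ^ i ∣ t ^ m - 1 → q ^ i ∣ C * m)
    {k : ℕ} (hpump : ∀ i : ℕ, 1 ≤ i → ∀ r : ℕ, r < q ^ i →
      (∀ n : ℕ, 1 ≤ n → n ≤ k → f (q ^ i * n + r) = 0) → ∀ n : ℕ, 1 ≤ n → f (q ^ i * n + r) = 0)
    (i : ℕ) (hi : 1 ≤ i) :
    q ^ i / C ≤ ((Finset.range ((k + 1) * q ^ i)).filter (fun x => f x ≠ 0)).card := by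
  set Q : ℕ := q ^ i with hQ
  have hQpos : 0 < Q := pow_pos (by omega) i
  have htQ : Nat.Coprime t Q := Nat.Coprime.pow_right i htq
  -- every class `t^j mod Q` has a nonzero value among the first `k` shifts
  have hW : ∀ j : ℕ, ∃ n : ℕ, 1 ≤ n ∧ n ≤ k ∧ f (Q * n + t ^ j % Q) ≠ 0 := by
    intro j
    by_contra hcon
    push Not at hcon
    have hall := hpump i hi (t ^ j % Q) (Nat.mod_lt _ hQpos) hcon
    -- the element t^(j + φ(Q) * Q) lies in the class and is nonzero
    set J : ℕ := j + Nat.totient Q * Q with hJ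
    have hmod : t ^ J ≡ t ^ j [MOD Q] := by
      have h := Nat.ModEq.pow_totient htQ
      have : t ^ J = t ^ j * (t ^ Nat.totient Q) ^ Q := by
        rw [hJ, pow_add, pow_mul]
      rw [this]
      calc t ^ j * (t ^ Nat.totient Q) ^ Q ≡ t ^ j * 1 ^ Q [MOD Q] :=
            Nat.ModEq.mul_left _ (Nat.ModEq.pow _ h)
        _ = t ^ j := by rw [one_pow, mul_one]
    have hbig : Q < t ^ J := by
      have h2 : Q < 2 ^ Q := Nat.lt_two_pow_self
      have h3 : 2 ^ Q ≤ t ^ Q := Nat.pow_le_pow_left ht Q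
      have h4 : t ^ Q ≤ t ^ J := by
        apply Nat.pow_le_pow_right (by omega)
        rw [hJ]
        have : 1 ≤ Nat.totient Q := Nat.totient_pos.mpr hQpos
        nlinarith
      omega
    set n' : ℕ := t ^ J / Q with hn'
    have hdecomp : t ^ J = Q * n' + t ^ j % Q := by
      have h := Nat.div_add_mod (t ^ J) Q
      have h2 : t ^ J % Q = t ^ j % Q := hmod
      rw [h2] at h
      exact h.symm
    have hn'1 : 1 ≤ n' := by
      rw [hn']
      exact (Nat.one_le_div_iff hQpos).mpr hbig.le
    have hz := hall n' hn'1
    rw [← hdecomp, cm_map_pow hf h1] at hz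
    exact pow_ne_zero _ hft hz
  choose nn hnn1 hnnk hnnf using hW
  -- the injection j ↦ Q * nn j + t^j % Q
  have hmaps : Set.MapsTo (fun j => Q * nn j + t ^ j % Q) (Finset.range (Q / C) : Set ℕ)
      (((Finset.range ((k + 1) * Q)).filter (fun x => f x ≠ 0)) : Set ℕ) := by
    intro j _
    simp only [Finset.coe_filter, Set.mem_setOf_eq, Finset.mem_range]
    refine ⟨?_, hnnf j⟩
    have h1' : t ^ j % Q < Q := Nat.mod_lt _ hQpos
    have h2' : Q * nn j ≤ Q * k := Nat.mul_le_mul_left _ (hnnk j)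
    nlinarith
  have hinj : Set.InjOn (fun j => Q * nn j + t ^ j % Q) (Finset.range (Q / C) : Set ℕ) := by
    -- first: equal values force equal residues, hence a small power of t ≡ 1
    have key : ∀ j₁ j₂ : ℕ, j₁ ≤ j₂ → j₂ < Q / C → t ^ j₁ % Q = t ^ j₂ % Q → j₁ = j₂ := by
      intro j₁ j₂ hle hj₂ hres
      obtain ⟨e, rfl⟩ := Nat.exists_eq_add_of_le hle
      rcases Nat.eq_zero_or_pos e with he | he
      · omega
      exfalso
      have hm : t ^ j₁ * t ^ e ≡ t ^ j₁ * 1 [MOD Q] := by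
        rw [mul_one, ← pow_add]; exact hres.symm
      have hcop : Nat.gcd Q (t ^ j₁) = 1 := (Nat.Coprime.pow_left j₁ htQ).symm
      have h1e : t ^ e ≡ 1 [MOD Q] := Nat.ModEq.cancel_left_of_coprime hcop hm
      have hdvd : Q ∣ t ^ e - 1 :=
        (Nat.modEq_iff_dvd' (Nat.one_le_pow _ _ (by omega))).mp h1e.symm
      have hdvd' : Q ∣ C * e := hord i e he hdvd
      have hle' : Q ≤ C * e := Nat.le_of_dvd (Nat.mul_pos hC he) hdvd'
      have hlt : e < Q / C := by omega
      have : (e + 1) * C ≤ Q := (Nat.le_div_iff_mul_le hC).mp hlt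
      nlinarith
    intro j₁ hj₁ j₂ hj₂ heq
    simp only [Finset.coe_range, Set.mem_Iio] at hj₁ hj₂
    have hres : t ^ j₁ % Q = t ^ j₂ % Q := by
      have h := congrArg (fun x => x % Q) heq
      simpa [Nat.mul_add_mod, Nat.mod_mod] using h
    rcases le_total j₁ j₂ with h | h
    · exact key j₁ j₂ h hj₂ hres
    · exact (key j₂ j₁ h hj₁ hres.symm).symm
  have := Finset.card_le_card_of_injOn _ hmaps hinj
  simpa using this

end ManyNonzero

/-! ### (d) Residues of the nonvanishing set modulo products of zero primes -/

section Residues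

variable {f : ℕ → ℂ}

/-- The set of residues modulo `P` of the nonvanishing set `S = {s : f s ≠ 0}` (as a finset of
naturals `< P`). [folklore] -/
theorem mem_residues_iff (P r : ℕ) :
    r ∈ (Finset.range P).filter (fun r => ∃ s : ℕ, f s ≠ 0 ∧ s % P = r) ↔
      r < P ∧ ∃ s : ℕ, f s ≠ 0 ∧ s % P = r := by
  simp

/-- Counting along periods: `#(S ∩ [0, N·P)) ≤ N · #(residues of S mod P)`. [folklore] -/
theorem card_nonzero_range_mul_le (P N : ℕ) (hP : 0 < P) :
    ((Finset.range (N * P)).filter (fun x => f x ≠ 0)).card ≤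
      N * ((Finset.range P).filter (fun r => ∃ s : ℕ, f s ≠ 0 ∧ s % P = r)).card := by
  have hmaps : Set.MapsTo (fun x => (x / P, x % P))
      (((Finset.range (N * P)).filter (fun x => f x ≠ 0)) : Set ℕ)
      (((Finset.range N) ×ˢ ((Finset.range P).filter (fun r => ∃ s : ℕ, f s ≠ 0 ∧ s % P = r)) :
        Finset (ℕ × ℕ)) : Set (ℕ × ℕ)) := by
    intro x hx
    simp only [Finset.coe_filter, Finset.mem_range, Set.mem_setOf_eq] at hx
    simp only [Finset.coe_product, Finset.coe_filter, Finset.coe_range, Set.mem_prod, Set.mem_Iio,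
      Set.mem_setOf_eq, Finset.mem_range]
    exact ⟨(Nat.div_lt_iff_lt_mul hP).mpr hx.1, Nat.mod_lt _ hP, x, hx.2, rfl⟩
  have hinj : Set.InjOn (fun x => (x / P, x % P))
      (((Finset.range (N * P)).filter (fun x => f x ≠ 0)) : Set ℕ) := by
    intro x _ y _ hxy
    simp only [Prod.mk.injEq] at hxy
    rw [← Nat.div_add_mod x P, ← Nat.div_add_mod y P, hxy.1, hxy.2]
  have := Finset.card_le_card_of_injOn _ hmaps hinj
  simpa [Finset.card_product] using this

/-- CRT: residues of `S` modulo a coprime product inject into pairs of residues.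
[folklore] -/
theorem card_residues_mul_le (P₁ P₂ : ℕ) (h₁ : 0 < P₁) (h₂ : 0 < P₂) (hcop : Nat.Coprime P₁ P₂) :
    ((Finset.range (P₁ * P₂)).filter (fun r => ∃ s : ℕ, f s ≠ 0 ∧ s % (P₁ * P₂) = r)).card ≤
      ((Finset.range P₁).filter (fun r => ∃ s : ℕ, f s ≠ 0 ∧ s % P₁ = r)).card *
        ((Finset.range P₂).filter (fun r => ∃ s : ℕ, f s ≠ 0 ∧ s % P₂ = r)).card := by
  have hmaps : Set.MapsTo (fun r => (r % P₁, r % P₂))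
      (((Finset.range (P₁ * P₂)).filter (fun r => ∃ s : ℕ, f s ≠ 0 ∧ s % (P₁ * P₂) = r)) : Set ℕ)
      (((((Finset.range P₁).filter (fun r => ∃ s : ℕ, f s ≠ 0 ∧ s % P₁ = r)) ×ˢ
        ((Finset.range P₂).filter (fun r => ∃ s : ℕ, f s ≠ 0 ∧ s % P₂ = r))) :
          Finset (ℕ × ℕ)) : Set (ℕ × ℕ)) := by
    intro r hr
    simp only [Finset.coe_filter, Finset.mem_range, Set.mem_setOf_eq] at hr
    obtain ⟨_, s, hs, rfl⟩ := hr
    simp only [Finset.coe_product, Finset.coe_filter, Finset.mem_range, Set.mem_prod,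
      Set.mem_setOf_eq]
    exact ⟨⟨Nat.mod_lt _ h₁, s, hs, (Nat.mod_mul_right_mod s P₁ P₂).symm⟩,
      ⟨Nat.mod_lt _ h₂, s, hs, (Nat.mod_mul_left_mod s P₁ P₂).symm⟩⟩
  have hinj : Set.InjOn (fun r => (r % P₁, r % P₂))
      (((Finset.range (P₁ * P₂)).filter
        (fun r => ∃ s : ℕ, f s ≠ 0 ∧ s % (P₁ * P₂) = r)) : Set ℕ) := by
    intro x hx y hy hxy
    simp only [Finset.coe_filter, Finset.mem_range, Set.mem_setOf_eq] at hx hy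
    simp only [Prod.mk.injEq] at hxy
    have h : x ≡ y [MOD P₁ * P₂] :=
      (Nat.modEq_and_modEq_iff_modEq_mul hcop).mp ⟨hxy.1, hxy.2⟩
    exact Nat.ModEq.eq_of_lt_of_lt h hx.1 hy.1
  have := Finset.card_le_card_of_injOn _ hmaps hinj
  simpa [Finset.card_product] using this

/-- **Hand-made Lagrange.** A multiplicatively closed set `A` of unit residues modulo `P`
containing `1` and missing some unit residue `u` has `2·#A ≤ P`: the translate `u·A` is
disjoint from `A` (inverses in `A` are powers, by Euler's theorem). [folklore] -/
theorem two_mul_card_le_of_missing (P : ℕ) (hP : 0 < P) (A : Finset ℕ)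
    (hAP : ∀ a ∈ A, a < P) (hcop : ∀ a ∈ A, Nat.Coprime a P)
    (hmul : ∀ a ∈ A, ∀ b ∈ A, (a * b) % P ∈ A) (hone : 1 % P ∈ A)
    {u : ℕ} (huP : u < P) (hu : Nat.Coprime u P) (huA : u ∉ A) : 2 * A.card ≤ P := by
  -- powers stay in A
  have hpow : ∀ a ∈ A, ∀ n : ℕ, (a ^ n) % P ∈ A := by
    intro a ha n
    induction n with
    | zero => simpa using hone
    | succ n ih =>
      have := hmul _ ih a ha
      rwa [Nat.mod_mul_mod, ← pow_succ] at this
  set T : Finset ℕ := A.image (fun a => (u * a) % P) with hT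
  have hTcard : T.card = A.card := by
    apply Finset.card_image_of_injOn
    intro a ha b hb hab
    have hab' : u * a ≡ u * b [MOD P] := hab
    have h := Nat.ModEq.cancel_left_of_coprime (Nat.Coprime.symm hu ▸ rfl : Nat.gcd P u = 1) hab'
    exact Nat.ModEq.eq_of_lt_of_lt h (hAP a ha) (hAP b hb)
  have hdisj : Disjoint T A := by
    rw [Finset.disjoint_left]
    intro b hbT hbA
    rw [hT, Finset.mem_image] at hbT
    obtain ⟨a, ha, rfl⟩ := hbT
    -- u ≡ u * a^φ = (u a) a^(φ-1)
    have hφ : 1 ≤ Nat.totient P := Nat.totient_pos.mpr hP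
    have ha' : (a ^ (Nat.totient P - 1)) % P ∈ A := hpow a ha _
    have hprod := hmul _ hbA _ ha'
    have heq : (u * a % P * (a ^ (Nat.totient P - 1) % P)) % P = u := by
      rw [Nat.mod_mul_mod, Nat.mul_mod_mod, mul_assoc, ← pow_succ',
        Nat.sub_add_cancel hφ]
      have h := Nat.ModEq.pow_totient (hcop a ha)
      calc u * a ^ Nat.totient P % P = (u * 1) % P := Nat.ModEq.mul_left u h
        _ = u := by rw [mul_one, Nat.mod_eq_of_lt huP]
    rw [heq] at hprod
    exact huA hprod
  have hTP : T ⊆ Finset.range P := by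
    intro x hx
    rw [hT, Finset.mem_image] at hx
    obtain ⟨a, _, rfl⟩ := hx
    exact Finset.mem_range.mpr (Nat.mod_lt _ hP)
  have hAP' : A ⊆ Finset.range P := fun a ha => Finset.mem_range.mpr (hAP a ha)
  have hunion : (T ∪ A).card ≤ P := by
    simpa using Finset.card_le_card (Finset.union_subset hTP hAP')
  rw [Finset.card_union_of_disjoint hdisj, hTcard] at hunion
  omega

end Residues

/-! ### (e) A block of zero primes all of whose unit residues are hit is contradictory -/

section Blocks

variable {q : ℕ} {f : ℕ → ℂ}

/-- **Good block ⇒ contradiction** (the CRT step of [KK, Lemma 2.2 / proof of Prop 2.4], with the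
primitive-root input replaced by the hypothesis that every unit residue modulo the block product
is a residue of the nonvanishing set). [cite: KlurmanKurlberg2019, Lemma 2.2] -/
theorem false_of_full_block (hq : 2 ≤ q) (hf : ∀ m n : ℕ, f (m * n) = f m * f n) (h1 : f 1 = 1)
    (h0 : f 0 = 0) {t : ℕ} (ht : 2 ≤ t) (htq : Nat.Coprime t q) (hft : f t ≠ 0) {k : ℕ}
    (hpump : ∀ i : ℕ, 1 ≤ i → ∀ r : ℕ, r < q ^ i →
      (∀ n : ℕ, 1 ≤ n → n ≤ k → f (q ^ i * n + r) = 0) → ∀ n : ℕ, 1 ≤ n → f (q ^ i * n + r) = 0)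
    (B : Finset ℕ) (hBk : B.card = k) (hB : ∀ p ∈ B, p.Prime ∧ f p = 0 ∧ q < p ∧ k < p)
    (hfull : ∀ v : ℕ, Nat.Coprime v (∏ p ∈ B, p) →
      ∃ s : ℕ, f s ≠ 0 ∧ s % (∏ p ∈ B, p) = v % (∏ p ∈ B, p)) : False := by
  set P : ℕ := ∏ p ∈ B, p with hP
  have hPpos : 0 < P := Finset.prod_pos (fun p hp => (hB p hp).1.pos)
  have hpair : Set.Pairwise (B : Set ℕ) (Function.onFun Nat.Coprime id) := by
    intro a ha b hb hab
    exact (Nat.coprime_primes (hB a ha).1 (hB b hb).1).mpr hab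
  -- enumerate the block
  let e : {x // x ∈ B} ≃ Fin k := B.equivFin.trans (finCongr hBk)
  let idx : ℕ → ℕ := fun p => if hp : p ∈ B then (e ⟨p, hp⟩ : ℕ) + 1 else 0
  have hidx : ∀ p (hp : p ∈ B), idx p = (e ⟨p, hp⟩ : ℕ) + 1 := fun p hp => dif_pos hp
  have hidx1 : ∀ p ∈ B, 1 ≤ idx p ∧ idx p ≤ k := by
    intro p hp
    rw [hidx p hp]
    exact ⟨by omega, (e ⟨p, hp⟩).isLt⟩
  -- CRT: v ≡ -(idx p)·q (mod p) for every p in the block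
  obtain ⟨v, hv⟩ := Nat.chineseRemainderOfFinset (fun p => p - (idx p * q) % p) id B
    (fun p hp => (hB p hp).1.ne_zero) hpair
  have hvq : ∀ p ∈ B, p ∣ v + idx p * q := by
    intro p hp
    have hpr := (hB p hp).1
    have h : v ≡ p - (idx p * q) % p [MOD p] := hv p hp
    have hlt : (idx p * q) % p < p := Nat.mod_lt _ hpr.pos
    have h' : v + idx p * q ≡ (p - (idx p * q) % p) + (idx p * q) % p [MOD p] :=
      Nat.ModEq.add h (Nat.mod_modEq _ _).symm
    rw [Nat.sub_add_cancel hlt.le] at h'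
    exact Nat.modEq_zero_iff_dvd.mp (h'.trans (Nat.modEq_zero_iff_dvd.mpr dvd_rfl))
  have hvcop : Nat.Coprime v P := by
    apply Nat.Coprime.prod_right
    intro p hp
    have hpr := (hB p hp).1
    rw [Nat.coprime_comm, Nat.Prime.coprime_iff_not_dvd hpr]
    intro hpv
    have h : p ∣ idx p * q := (Nat.dvd_add_right hpv).mp (hvq p hp)
    rcases (Nat.Prime.dvd_mul hpr).mp h with h' | h'
    · have := Nat.le_of_dvd (by have := (hidx1 p hp).1; omega) h'
      have := (hidx1 p hp).2
      have := (hB p hp).2.2.2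
      omega
    · have := Nat.le_of_dvd (by omega) h'
      have := (hB p hp).2.2.1
      omega
  obtain ⟨σ, hσ, hσv⟩ := hfull v hvcop
  have hσ1 : 1 ≤ σ := by
    rcases Nat.eq_zero_or_pos σ with h | h
    · rw [h] at hσ; exact absurd h0 hσ
    · exact h
  have hqP : Nat.Coprime q P := by
    apply Nat.Coprime.prod_right
    intro p hp
    have hpr := (hB p hp).1
    rw [Nat.coprime_comm, Nat.Prime.coprime_iff_not_dvd hpr]
    intro h
    have := Nat.le_of_dvd (by omega) h
    have := (hB p hp).2.2.1
    omega
  -- the level i with q^i ≡ q (mod P) and q^i > σ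
  set i : ℕ := 1 + Nat.totient P * σ with hi
  have hi1 : 1 ≤ i := by omega
  have hφP : 1 ≤ Nat.totient P := Nat.totient_pos.mpr hPpos
  have hqi : q ^ i ≡ q [MOD P] := by
    have h := Nat.ModEq.pow_totient hqP
    have : q ^ i = q * (q ^ Nat.totient P) ^ σ := by rw [hi, pow_add, pow_one, pow_mul]
    rw [this]
    calc q * (q ^ Nat.totient P) ^ σ ≡ q * 1 ^ σ [MOD P] :=
          Nat.ModEq.mul_left _ (Nat.ModEq.pow _ h)
      _ = q := by rw [one_pow, mul_one]
  have hσlt : σ < q ^ i := by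
    have h2 : i < 2 ^ i := Nat.lt_two_pow_self
    have h3 : 2 ^ i ≤ q ^ i := Nat.pow_le_pow_left hq i
    have h4 : σ < i := by rw [hi]; nlinarith
    omega
  -- the first k shifts of σ are killed by the block primes
  have hzero : ∀ n : ℕ, 1 ≤ n → n ≤ k → f (q ^ i * n + σ) = 0 := by
    intro n hn1 hnk
    have hlt : n - 1 < k := by omega
    set x : {x // x ∈ B} := e.symm ⟨n - 1, hlt⟩ with hx
    have hp : (x : ℕ) ∈ B := x.2
    have hidxp : idx x = n := by
      have h' : idx x = (e x : ℕ) + 1 := hidx x.1 x.2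
      rw [h', hx, Equiv.apply_symm_apply]
      simp only
      omega
    apply cm_eq_zero_of_dvd hf (hB x hp).2.1
    -- x ∣ q^i * n + σ
    have hxP : (x : ℕ) ∣ P := by
      rw [hP]; exact Finset.dvd_prod_of_mem (fun p : ℕ => p) hp
    have hmod1 : q ^ i * n + σ ≡ q * n + v [MOD (x : ℕ)] := by
      have ha : q ^ i ≡ q [MOD (x : ℕ)] := Nat.ModEq.of_dvd hxP hqi
      have hb : σ ≡ v [MOD (x : ℕ)] := Nat.ModEq.of_dvd hxP hσv
      exact Nat.ModEq.add (Nat.ModEq.mul_right _ ha) hb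
    have hdv : (x : ℕ) ∣ q * n + v := by
      have := hvq x hp
      rw [hidxp] at this
      have e' : q * n + v = v + n * q := by ring
      rw [e']; exact this
    exact (Nat.modEq_zero_iff_dvd.mp (hmod1.trans (Nat.modEq_zero_iff_dvd.mpr hdv)))
  have hall := hpump i hi1 σ hσlt hzero
  -- but σ · t^{φ(q^i)} lies in the class of σ and does not vanish
  set T : ℕ := t ^ Nat.totient (q ^ i) with hT
  have hqipos : 0 < q ^ i := pow_pos (by omega) i
  have hT1 : T ≡ 1 [MOD q ^ i] := Nat.ModEq.pow_totient (Nat.Coprime.pow_right i htq)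
  have hT2 : 2 ≤ T := by
    have : 1 ≤ Nat.totient (q ^ i) := Nat.totient_pos.mpr hqipos
    calc 2 ≤ t := ht
      _ ≤ t ^ Nat.totient (q ^ i) := Nat.le_self_pow (by omega) t
  have hσT : σ * T ≡ σ [MOD q ^ i] := by
    calc σ * T ≡ σ * 1 [MOD q ^ i] := Nat.ModEq.mul_left _ hT1
      _ = σ := mul_one σ
  have hle : σ ≤ σ * T := Nat.le_mul_of_pos_right _ (by omega)
  have hdvd : q ^ i ∣ σ * T - σ := (Nat.modEq_iff_dvd' hle).mp hσT.symm
  obtain ⟨n', hn'⟩ := hdvd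
  have hn'1 : 1 ≤ n' := by
    rcases Nat.eq_zero_or_pos n' with h | h
    · exfalso
      rw [h, mul_zero] at hn'
      have : σ * 2 ≤ σ * T := Nat.mul_le_mul_left _ hT2
      omega
    · exact h
  have heq : σ * T = q ^ i * n' + σ := by omega
  have hz := hall n' hn'1
  rw [← heq, hf, hT, cm_map_pow hf h1] at hz
  exact mul_ne_zero hσ (pow_ne_zero _ hft) hz

/-- **No good block ⇒ arbitrarily thin residue sets.** If no block of `k` zero primes has all its
unit residues hit by the nonvanishing set, then for every `J` there is a modulus `P > 0` such
that the nonvanishing set occupies at most `P/2^J` residues mod `P` (induction on `J`, adding a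
fresh block each time: hand-made Lagrange + CRT). [folklore] -/
theorem exists_thin_modulus (hf : ∀ m n : ℕ, f (m * n) = f m * f n) (h1 : f 1 = 1) (k : ℕ)
    (hinf : {p : ℕ | p.Prime ∧ f p = 0}.Infinite)
    (hno : ∀ B : Finset ℕ, B.card = k → (∀ p ∈ B, p.Prime ∧ f p = 0 ∧ q < p ∧ k < p) →
      (∀ v : ℕ, Nat.Coprime v (∏ p ∈ B, p) →
        ∃ s : ℕ, f s ≠ 0 ∧ s % (∏ p ∈ B, p) = v % (∏ p ∈ B, p)) → False)
    (J : ℕ) :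
    ∃ P : ℕ, 0 < P ∧
      2 ^ J * ((Finset.range P).filter (fun r => ∃ s : ℕ, f s ≠ 0 ∧ s % P = r)).card ≤ P := by
  induction J with
  | zero =>
    refine ⟨1, one_pos, ?_⟩
    rw [pow_zero, one_mul]
    exact (Finset.card_filter_le _ _).trans (by simp)
  | succ J ih =>
    obtain ⟨P, hP, hcard⟩ := ih
    have hinf' : {p : ℕ | p.Prime ∧ f p = 0 ∧ P < p ∧ q < p ∧ k < p}.Infinite := by
      have hsub : {p : ℕ | p.Prime ∧ f p = 0} \ Set.Iic (P + q + k) ⊆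
          {p : ℕ | p.Prime ∧ f p = 0 ∧ P < p ∧ q < p ∧ k < p} := by
        intro p hp
        simp only [Set.mem_sdiff, Set.mem_setOf_eq, Set.mem_Iic, not_le] at hp
        exact ⟨hp.1.1, hp.1.2, by omega, by omega, by omega⟩
      exact Set.Infinite.mono hsub (hinf.sdiff (Set.finite_Iic _))
    obtain ⟨B, hBsub, hBk⟩ := hinf'.exists_subset_card_eq k
    have hB : ∀ p ∈ B, p.Prime ∧ f p = 0 ∧ P < p ∧ q < p ∧ k < p :=
      fun p hp => hBsub (Finset.mem_coe.mpr hp)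
    set PB : ℕ := ∏ p ∈ B, p with hPB
    have hPBpos : 0 < PB := Finset.prod_pos (fun p hp => (hB p hp).1.pos)
    -- the block is not full: some unit residue v is missed
    obtain ⟨v, hvcop, hvmiss⟩ : ∃ v : ℕ, Nat.Coprime v PB ∧
        ∀ s : ℕ, f s ≠ 0 → s % PB ≠ v % PB := by
      by_contra hcon
      push Not at hcon
      exact hno B hBk (fun p hp => ⟨(hB p hp).1, (hB p hp).2.1, (hB p hp).2.2.2.1,
        (hB p hp).2.2.2.2⟩) hcon
    -- elements of S are coprime to PB
    have hScop : ∀ s : ℕ, f s ≠ 0 → Nat.Coprime s PB := by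
      intro s hs
      apply Nat.Coprime.prod_right
      intro p hp
      rw [Nat.coprime_comm, Nat.Prime.coprime_iff_not_dvd (hB p hp).1]
      intro h
      exact hs (cm_eq_zero_of_dvd hf (hB p hp).2.1 h)
    have hmodcop : ∀ s : ℕ, Nat.Coprime s PB → Nat.Coprime (s % PB) PB := by
      intro s hs
      have : Nat.gcd (s % PB) PB = Nat.gcd PB s := (Nat.gcd_rec PB s).symm
      rw [Nat.Coprime, this]
      exact Nat.Coprime.symm hs
    have hA2 : 2 * ((Finset.range PB).filter (fun r => ∃ s : ℕ, f s ≠ 0 ∧ s % PB = r)).card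
        ≤ PB := by
      apply two_mul_card_le_of_missing PB hPBpos _ ?_ ?_ ?_ ?_ (Nat.mod_lt v hPBpos)
        (hmodcop v hvcop) ?_
      · intro a ha
        exact ((mem_residues_iff PB a).mp ha).1
      · intro a ha
        obtain ⟨_, s, hs, rfl⟩ := (mem_residues_iff PB a).mp ha
        exact hmodcop s (hScop s hs)
      · intro a ha b hb
        obtain ⟨_, s₁, hs₁, rfl⟩ := (mem_residues_iff PB a).mp ha
        obtain ⟨_, s₂, hs₂, rfl⟩ := (mem_residues_iff PB b).mp hb
        refine (mem_residues_iff PB _).mpr ⟨Nat.mod_lt _ hPBpos, s₁ * s₂, cm_mul_ne_zero hf hs₁ hs₂, ?_⟩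
        exact Nat.mul_mod _ _ _
      · refine (mem_residues_iff PB _).mpr ⟨Nat.mod_lt _ hPBpos, 1, by rw [h1]; exact one_ne_zero, rfl⟩
      · intro hmem
        obtain ⟨_, s, hs, hsv⟩ := (mem_residues_iff PB _).mp hmem
        exact hvmiss s hs hsv
    have hcopP : Nat.Coprime P PB := by
      apply Nat.Coprime.prod_right
      intro p hp
      rw [Nat.coprime_comm, Nat.Prime.coprime_iff_not_dvd (hB p hp).1]
      intro h
      have := Nat.le_of_dvd hP h
      have := (hB p hp).2.2.1
      omega
    refine ⟨P * PB, Nat.mul_pos hP hPBpos, ?_⟩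
    calc 2 ^ (J + 1) *
          ((Finset.range (P * PB)).filter (fun r => ∃ s : ℕ, f s ≠ 0 ∧ s % (P * PB) = r)).card
        ≤ 2 ^ (J + 1) *
          (((Finset.range P).filter (fun r => ∃ s : ℕ, f s ≠ 0 ∧ s % P = r)).card *
            ((Finset.range PB).filter (fun r => ∃ s : ℕ, f s ≠ 0 ∧ s % PB = r)).card) :=
          Nat.mul_le_mul_left _ (card_residues_mul_le P PB hP hPBpos hcopP)
      _ = (2 ^ J * ((Finset.range P).filter (fun r => ∃ s : ℕ, f s ≠ 0 ∧ s % P = r)).card) *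
          (2 * ((Finset.range PB).filter (fun r => ∃ s : ℕ, f s ≠ 0 ∧ s % PB = r)).card) := by
          ring
      _ ≤ P * PB := Nat.mul_le_mul hcard hA2

end Blocks

/-! ### The sparse half of Theorem 1.3 -/

section Sparse

variable {q : ℕ} {f : ℕ → ℂ}

/-- **Klurman–Kurlberg 2019, Proposition 2.4 (sparse case of Theorem 1.3), strengthened form.**
Let `q ≥ 2` and let `f : ℕ → ℂ` be completely multiplicative with finite `q`-kernel. If
`f(p) = 0` for infinitely many primes `p`, then `f(p) = 0` for EVERY prime `p ∤ q` (the paper: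
"for all sufficiently large primes `p`"). The printed proof combines Lemma 2.2 (CRT + pumping)
with Heath-Brown's theorem on Artin's conjecture (Lemma 2.3); this formalization keeps Lemma 2.2
(`false_of_full_block`) and replaces Heath-Brown by an elementary counting argument
(`card_nonzero_ge`, `exists_thin_modulus`): were some prime `t ∤ q` to have `f t ≠ 0`, the
nonvanishing set would have `≫ qⁱ` elements below `(k+1)qⁱ`, which is incompatible with it
missing unit residues modulo many disjoint blocks of zero primes; and a block missing none is
contradictory by Lemma 2.2. [cite: KlurmanKurlberg2019, Prop 2.4] -/
theorem KlurmanKurlberg2019_prop24 (hq : 2 ≤ q) (hf : ∀ m n : ℕ, f (m * n) = f m * f n)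
    (hA : IsAutomaticSeq q f) (hinf : {p : ℕ | p.Prime ∧ f p = 0}.Infinite) :
    ∀ p : ℕ, p.Prime → ¬ p ∣ q → f p = 0 := by
  by_contra hcon
  push Not at hcon
  obtain ⟨t, htp, htq', hft⟩ := hcon
  have ht : 2 ≤ t := htp.two_le
  have htq : Nat.Coprime t q := (Nat.Prime.coprime_iff_not_dvd htp).mpr htq'
  have h1 : f 1 = 1 := cm_map_one hf hft
  obtain ⟨p₀, hp₀⟩ := hinf.nonempty
  have h0 : f 0 = 0 := cm_map_zero hf hp₀.2
  obtain ⟨k, hpump⟩ := exists_pumping_const hA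
  obtain ⟨C, hC, hord⟩ := exists_dvd_mul_of_pow_dvd_pow_sub_one (q := q) (by omega) ht htq
  by_cases hgood : ∃ B : Finset ℕ, B.card = k ∧ (∀ p ∈ B, p.Prime ∧ f p = 0 ∧ q < p ∧ k < p) ∧
      (∀ v : ℕ, Nat.Coprime v (∏ p ∈ B, p) →
        ∃ s : ℕ, f s ≠ 0 ∧ s % (∏ p ∈ B, p) = v % (∏ p ∈ B, p))
  · obtain ⟨B, hBk, hB, hfull⟩ := hgood
    exact false_of_full_block hq hf h1 h0 ht htq hft hpump B hBk hB hfull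
  · have hno : ∀ B : Finset ℕ, B.card = k → (∀ p ∈ B, p.Prime ∧ f p = 0 ∧ q < p ∧ k < p) →
        (∀ v : ℕ, Nat.Coprime v (∏ p ∈ B, p) →
          ∃ s : ℕ, f s ≠ 0 ∧ s % (∏ p ∈ B, p) = v % (∏ p ∈ B, p)) → False :=
      fun B hBk hB hfull => hgood ⟨B, hBk, hB, hfull⟩
    set J : ℕ := 4 * C * (k + 1) with hJ
    obtain ⟨P, hP, hthin⟩ := exists_thin_modulus (q := q) hf h1 k hinf hno J
    have hJge : 4 * C * (k + 1) ≤ 2 ^ J := (Nat.lt_two_pow_self).le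
    -- every scale q^i is bounded by P * C
    have key : ∀ i : ℕ, 1 ≤ i → q ^ i < P * C := by
      intro i hi
      have hc := card_nonzero_ge hq hf h1 ht htq hft hC hord hpump i hi
      set a : ℕ := q ^ i / C with ha
      set N : ℕ := (k + 1) * q ^ i / P + 1 with hN
      have hNP1 : (k + 1) * q ^ i < N * P := by
        have h := Nat.lt_div_mul_add (a := (k + 1) * q ^ i) hP
        have e1 : N * P = (k + 1) * q ^ i / P * P + P := by rw [hN]; ring
        rw [e1]; exact h
      have hNP2 : N * P ≤ (k + 1) * q ^ i + P := by
        have h := Nat.div_mul_le_self ((k + 1) * q ^ i) P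
        have e1 : N * P = (k + 1) * q ^ i / P * P + P := by rw [hN]; ring
        rw [e1]; omega
      have hsub : ((Finset.range ((k + 1) * q ^ i)).filter (fun x => f x ≠ 0)).card ≤
          ((Finset.range (N * P)).filter (fun x => f x ≠ 0)).card :=
        Finset.card_le_card (Finset.filter_subset_filter _ (Finset.range_subset_range.mpr hNP1.le))
      have hcnt := card_nonzero_range_mul_le (f := f) P N hP
      have h2J : 2 ^ J * a ≤ N * P :=
        calc 2 ^ J * a
            ≤ 2 ^ J * (N * ((Finset.range P).filter
                (fun r => ∃ s : ℕ, f s ≠ 0 ∧ s % P = r)).card) :=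
              Nat.mul_le_mul_left _ (hc.trans (hsub.trans hcnt))
          _ = N * (2 ^ J * ((Finset.range P).filter
                (fun r => ∃ s : ℕ, f s ≠ 0 ∧ s % P = r)).card) := by ring
          _ ≤ N * P := Nat.mul_le_mul_left _ hthin
      have hqa : q ^ i < (a + 1) * C := by
        rw [add_mul, one_mul, ha]
        exact Nat.lt_div_mul_add hC
      have hmain : 4 * C * (k + 1) * a < (k + 1) * ((a + 1) * C) + P := by
        calc 4 * C * (k + 1) * a ≤ 2 ^ J * a := Nat.mul_le_mul_right _ hJge
          _ ≤ (k + 1) * q ^ i + P := h2J.trans hNP2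
          _ < (k + 1) * ((a + 1) * C) + P := by
              have : (k + 1) * q ^ i < (k + 1) * ((a + 1) * C) :=
                Nat.mul_lt_mul_of_pos_left hqa (by omega)
              omega
      have haP : a < P := by
        by_contra hle
        push Not at hle
        have ha1 : 1 ≤ a := le_trans hP hle
        have i1 : C * k * 1 ≤ C * k * a := Nat.mul_le_mul_left _ ha1
        have i2 : C * 1 ≤ C * a := Nat.mul_le_mul_left _ ha1
        have i3 : 1 * P ≤ C * a := Nat.mul_le_mul hC hle
        nlinarith
      calc q ^ i < (a + 1) * C := hqa
        _ ≤ P * C := Nat.mul_le_mul_right _ haP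
    have h1' : 1 ≤ P * C := Nat.mul_pos hP hC
    have hlt := key (P * C) h1'
    have h2 : P * C < 2 ^ (P * C) := Nat.lt_two_pow_self
    have h3 : 2 ^ (P * C) ≤ q ^ (P * C) := Nat.pow_le_pow_left hq _
    omega

/-- **Klurman–Kurlberg 2019, Proposition 2.4** in the printed form: infinitely many zero primes
force `f(p) = 0` for all sufficiently large primes (`P₀ = q + 1` works).
[cite: KlurmanKurlberg2019, Prop 2.4] -/
theorem KlurmanKurlberg2019_prop24' (hq : 2 ≤ q) (hf : ∀ m n : ℕ, f (m * n) = f m * f n)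
    (hA : IsAutomaticSeq q f) (hinf : {p : ℕ | p.Prime ∧ f p = 0}.Infinite) :
    ∃ P₀ : ℕ, ∀ p : ℕ, p.Prime → P₀ ≤ p → f p = 0 := by
  refine ⟨q + 1, fun p hp hle => KlurmanKurlberg2019_prop24 hq hf hA hinf p hp ?_⟩
  intro h
  have := Nat.le_of_dvd (by omega) h
  omega

end Sparse

/-! ### The printed assembly: Theorem 1.3 from its two halves -/

section Assembly

/-- **Klurman–Kurlberg 2019, Theorem 1.3 from Proposition 2.1.** The printed proof of Theorem 1.3
is "Prop 2.1 (finitely many zero primes ⇒ Dirichlet character, via Elliott–Kish 2017 Thm 2) +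
Prop 2.4 (infinitely many zero primes ⇒ eventual vanishing)". With Prop 2.4 proved above
(`KlurmanKurlberg2019_prop24'`), Theorem 1.3 reduces to the dense half, taken here as the
explicit hypothesis `hdense` (Prop 2.1 in the rendering of the fact: some modulus `Q > 0` and a
Dirichlet character `χ` mod `Q` agreeing with `f` on the integers coprime to `Q`).
[cite: KlurmanKurlberg2019, Thm 1.3 and Prop 2.1] -/
theorem KlurmanKurlberg2019_thm13_of_prop21
    (hdense : ∀ q : ℕ, 2 ≤ q → ∀ f : ℕ → ℂ, (∀ m n : ℕ, f (m * n) = f m * f n) →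
      IsAutomaticSeq q f → {p : ℕ | p.Prime ∧ f p = 0}.Finite →
        ∃ Q : ℕ, 0 < Q ∧ ∃ χ : DirichletCharacter ℂ Q, ∀ n : ℕ, Nat.Coprime n Q → f n = χ n) :
    KlurmanKurlberg2019_thm13 := by
  intro q hq f hf hA
  by_cases hfin : {p : ℕ | p.Prime ∧ f p = 0}.Finite
  · obtain ⟨Q, hQ, χ, hχ⟩ := hdense q hq f hf hA hfin
    exact ⟨Q, hQ, χ, Or.inl hχ⟩
  · obtain ⟨P₀, hP₀⟩ := KlurmanKurlberg2019_prop24' hq hf hA hfin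
    exact ⟨1, one_pos, 1, Or.inr ⟨P₀, hP₀⟩⟩

end Assembly

/-! ### The dense half from Elliott–Kish (the printed proof of Proposition 2.1) -/

section Dense

variable {q : ℕ} {f : ℕ → ℂ}

/-- Expansion of a completely multiplicative function over the prime factorisation:
`f n = ∏ₚ f(p)^{vₚ(n)}` for `n ≠ 0`. [folklore] -/
theorem cm_eq_prod_factorization (hf : ∀ m n : ℕ, f (m * n) = f m * f n) (h1 : f 1 = 1)
    {n : ℕ} (hn : n ≠ 0) :
    f n = n.factorization.prod (fun p e => f p ^ e) := by
  let F : ℕ →* ℂ := { toFun := f, map_one' := h1, map_mul' := hf }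
  have hF : ∀ m : ℕ, f m = F m := fun _ => rfl
  conv_lhs => rw [← Nat.prod_factorization_pow_eq_self hn]
  rw [Finsupp.prod, Finsupp.prod, hF, map_prod]
  refine Finset.prod_congr rfl (fun p _ => ?_)
  rw [map_pow, ← hF]

/-- A completely multiplicative sequence with finite `q`-kernel takes finitely many values, so its
nonzero values are roots of unity; in particular they have norm `1` ([KK, §2, first remark]:
"the image of `f` is finite and therefore for any prime `p`, `f(p) = 0` or `f(p)` is a root of
unity"). [cite: KlurmanKurlberg2019, §2] -/
theorem norm_eq_one_of_ne_zero (hq : 2 ≤ q) (hf : ∀ m n : ℕ, f (m * n) = f m * f n)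
    (hA : IsAutomaticSeq q f) {x : ℕ} (hx : f x ≠ 0) : ‖f x‖ = 1 := by
  have h1 : f 1 = 1 := cm_map_one hf hx
  have hK : (qKernel q f).Finite := hA
  have hvals : (Set.range f).Finite := by
    have hsub : Set.range f ⊆ (fun g : ℕ → ℂ => g 0) '' (qKernel q f) := by
      rintro _ ⟨m, rfl⟩
      refine ⟨fun n => f (q ^ (m + 1) * n + m), ⟨m + 1, by omega, m, ?_, rfl⟩, by simp⟩
      calc m < 2 ^ m := Nat.lt_two_pow_self
        _ ≤ 2 ^ (m + 1) := Nat.pow_le_pow_right (by norm_num) (by omega)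
        _ ≤ q ^ (m + 1) := Nat.pow_le_pow_left hq _
    exact (hK.image _).subset hsub
  obtain ⟨j₁, j₂, hj, hjeq⟩ := Set.Finite.exists_lt_map_eq_of_forall_mem
    (f := fun j : ℕ => f x ^ j) (t := Set.range f) (fun j => ⟨x ^ j, cm_map_pow hf h1 x j⟩) hvals
  have hpow : f x ^ (j₂ - j₁) = 1 := by
    have h : f x ^ j₁ * f x ^ (j₂ - j₁) = f x ^ j₁ * 1 := by
      rw [← pow_add, Nat.add_sub_cancel' hj.le, mul_one]
      exact hjeq.symm
    exact mul_left_cancel₀ (pow_ne_zero _ hx) h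
  have hn : ‖f x‖ ^ (j₂ - j₁) = 1 := by rw [← norm_pow, hpow, norm_one]
  exact (pow_eq_one_iff_of_nonneg (norm_nonneg _) (by omega : j₂ - j₁ ≠ 0)).mp hn

/-- **Klurman–Kurlberg 2019, Proposition 2.1 from Elliott–Kish.** The printed proof of the dense
half: if only finitely many primes are zeros of the completely multiplicative `q`-automatic `f`,
then, `M` denoting their product, finiteness of the kernel gives `i₁ < i₂` with
`f(q^{i₁} n + 1) = f(q^{i₂} n + 1)` for all `n`; restricting to multiples of `M` and stripping
`f` of its zero primes gives a nowhere-vanishing completely multiplicative `g` with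
`g(a n + 1) = g(A n + 1)`, `a = q^{i₁}M ≠ A = q^{i₂}M`, to which Elliott–Kish, Mathematika 63
(2017), Theorem 2 applies ("then there is a Dirichlet character (mod δ) with which `g` coincides
on all primes that do not divide δ"). Elliott–Kish's theorem is NOT vendored here (its proof
rests on Tao's logarithmically averaged two-point Elliott conjecture); it enters as the explicit
hypothesis `hEK`, stated as the special case actually used (`b = B = 1`, common value `c = 1`,
`g` completely multiplicative and unimodular on the positive integers — i.e. a character of
`ℚ*_{>0}` into the unit circle, as in [EK] — and the modulus existential).
[cite: KlurmanKurlberg2019, Prop 2.1] -/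
theorem KlurmanKurlberg2019_prop21_of_ElliottKish
    (hEK : ∀ a A : ℕ, 0 < a → 0 < A → a ≠ A → ∀ g : ℕ → ℂ,
      (∀ m n : ℕ, 1 ≤ m → 1 ≤ n → g (m * n) = g m * g n) → (∀ n : ℕ, 1 ≤ n → ‖g n‖ = 1) →
      (∀ n : ℕ, 1 ≤ n → g (a * n + 1) = g (A * n + 1)) →
        ∃ Q : ℕ, 0 < Q ∧ ∃ χ : DirichletCharacter ℂ Q, ∀ p : ℕ, p.Prime → ¬ p ∣ Q → g p = χ p)
    (hq : 2 ≤ q) (hf : ∀ m n : ℕ, f (m * n) = f m * f n) (hA : IsAutomaticSeq q f)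
    (hfin : {p : ℕ | p.Prime ∧ f p = 0}.Finite) :
    ∃ Q : ℕ, 0 < Q ∧ ∃ χ : DirichletCharacter ℂ Q, ∀ n : ℕ, Nat.Coprime n Q → f n = χ n := by
  -- f 1 = 1: otherwise f ≡ 0 and every prime is a zero prime
  have h1 : f 1 = 1 := by
    by_contra h1
    have hf1 : f 1 = 0 := by
      have h := hf 1 1
      rw [one_mul] at h
      -- f 1 = f 1 * f 1
      have : f 1 * (f 1 - 1) = 0 := by rw [mul_sub, mul_one, ← h, sub_self]
      rcases mul_eq_zero.mp this with h' | h'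
      · exact h'
      · exact absurd (sub_eq_zero.mp h') h1
    apply hfin.not_infinite
    have : {p : ℕ | p.Prime ∧ f p = 0} = {p : ℕ | p.Prime} := by
      ext p
      simp only [Set.mem_setOf_eq, and_iff_left_iff_imp]
      intro _
      have h := hf 1 p
      rw [one_mul, hf1, zero_mul] at h
      exact h
    rw [this]
    exact Nat.infinite_setOf_prime
  -- the product M of the zero primes
  set M : ℕ := ∏ p ∈ hfin.toFinset, p with hM
  have hMpos : 0 < M := Finset.prod_pos (fun p hp => ((Set.Finite.mem_toFinset hfin).mp hp).1.pos)
  have hzeroM : ∀ p : ℕ, p.Prime → f p = 0 → p ∣ M := by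
    intro p hp hfp
    exact Finset.dvd_prod_of_mem (fun p : ℕ => p) ((Set.Finite.mem_toFinset hfin).mpr ⟨hp, hfp⟩)
  -- pigeonhole: two levels with the same kernel element along the class of 1
  have hK : (qKernel q f).Finite := hA
  obtain ⟨j₁, j₂, hj, hjeq⟩ := Set.Finite.exists_lt_map_eq_of_forall_mem
    (f := fun j : ℕ => (fun n : ℕ => f (q ^ (j + 1) * n + 1))) (t := qKernel q f) (by
      intro j
      refine ⟨j + 1, by omega, 1, ?_, rfl⟩
      calc 1 < 2 ^ (j + 1) := Nat.one_lt_two_pow (by omega)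
        _ ≤ q ^ (j + 1) := Nat.pow_le_pow_left hq _) hK
  set a : ℕ := q ^ (j₁ + 1) * M with ha
  set A : ℕ := q ^ (j₂ + 1) * M with hA'
  have hapos : 0 < a := Nat.mul_pos (pow_pos (by omega) _) hMpos
  have hApos : 0 < A := Nat.mul_pos (pow_pos (by omega) _) hMpos
  have haA : a ≠ A := by
    intro h
    have h' : q ^ (j₁ + 1) = q ^ (j₂ + 1) := Nat.eq_of_mul_eq_mul_right hMpos h
    have := Nat.pow_right_injective hq h'
    omega
  -- the stripped function g
  let g : ℕ → ℂ := fun n => n.factorization.prod (fun p e => if p ∣ M then 1 else f p ^ e)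
  have hg0 : ∀ p : ℕ, (fun e : ℕ => if p ∣ M then (1 : ℂ) else f p ^ e) 0 = 1 := by
    intro p; simp
  have hgadd : ∀ p : ℕ, ∀ e₁ e₂ : ℕ, (if p ∣ M then (1 : ℂ) else f p ^ (e₁ + e₂)) =
      (if p ∣ M then (1 : ℂ) else f p ^ e₁) * (if p ∣ M then (1 : ℂ) else f p ^ e₂) := by
    intro p e₁ e₂
    split_ifs <;> simp [pow_add]
  have hgmul : ∀ m n : ℕ, 1 ≤ m → 1 ≤ n → g (m * n) = g m * g n := by
    intro m n hm hn
    simp only [g]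
    rw [Nat.factorization_mul (by omega) (by omega), Finsupp.prod_add_index']
    · exact hg0
    · exact hgadd
  have hgprime : ∀ p : ℕ, p.Prime → g p = if p ∣ M then 1 else f p := by
    intro p hp
    simp only [g]
    rw [Nat.Prime.factorization hp, Finsupp.prod_single_index (hg0 p), pow_one]
  have hgne : ∀ n : ℕ, 1 ≤ n → g n ≠ 0 := by
    intro n hn
    simp only [g, Finsupp.prod]
    rw [Finset.prod_ne_zero_iff]
    intro p hp
    have hpp : p.Prime := Nat.prime_of_mem_primeFactors (by simpa using hp)
    split_ifs with h
    · exact one_ne_zero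
    · exact pow_ne_zero _ (fun h0 => h (hzeroM p hpp h0))
  -- g agrees with f on integers coprime to M
  have hgf : ∀ n : ℕ, n ≠ 0 → Nat.Coprime n M → g n = f n := by
    intro n hn hcop
    rw [cm_eq_prod_factorization hf h1 hn]
    simp only [g, Finsupp.prod]
    refine Finset.prod_congr rfl (fun p hp => ?_)
    have hpp : p.Prime := Nat.prime_of_mem_primeFactors (by simpa using hp)
    have hpn : p ∣ n := Nat.dvd_of_mem_primeFactors (by simpa using hp)
    have hpM : ¬ p ∣ M :=
      (Nat.Prime.coprime_iff_not_dvd hpp).mp (Nat.Coprime.coprime_dvd_left hpn hcop)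
    rw [if_neg hpM]
  -- the Elliott–Kish hypothesis applies to g with (a, A)
  have hgaA : ∀ n : ℕ, 1 ≤ n → g (a * n + 1) = g (A * n + 1) := by
    intro n hn
    have hc1 : Nat.Coprime (a * n + 1) M := by
      rw [Nat.coprime_comm, Nat.Coprime, Nat.gcd_comm]
      have : Nat.Coprime (a * n + 1) a := by simp
      exact Nat.Coprime.coprime_dvd_right (Dvd.intro_left _ rfl : M ∣ a) this
    have hc2 : Nat.Coprime (A * n + 1) M := by
      rw [Nat.coprime_comm, Nat.Coprime, Nat.gcd_comm]
      have : Nat.Coprime (A * n + 1) A := by simp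
      exact Nat.Coprime.coprime_dvd_right (Dvd.intro_left _ rfl : M ∣ A) this
    rw [hgf _ (by omega) hc1, hgf _ (by omega) hc2, ha, hA']
    have h : f (q ^ (j₁ + 1) * (M * n) + 1) = f (q ^ (j₂ + 1) * (M * n) + 1) :=
      congrFun hjeq (M * n)
    rw [mul_assoc, mul_assoc]
    exact h
  have hgnorm : ∀ n : ℕ, 1 ≤ n → ‖g n‖ = 1 := by
    intro n hn
    simp only [g, Finsupp.prod]
    rw [norm_prod]
    refine Finset.prod_eq_one (fun p hp => ?_)
    have hpp : p.Prime := Nat.prime_of_mem_primeFactors (by simpa using hp)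
    split_ifs with h
    · exact norm_one
    · rw [norm_pow, norm_eq_one_of_ne_zero hq hf hA (fun h0 => h (hzeroM p hpp h0)), one_pow]
  obtain ⟨Q, hQ, χ, hχ⟩ := hEK a A hapos hApos haA g hgmul hgnorm hgaA
  -- conclusion with modulus q · Q · M
  have hdvd : Q ∣ q * (Q * M) := ⟨q * M, by ring⟩
  refine ⟨q * (Q * M), Nat.mul_pos (by omega) (Nat.mul_pos hQ hMpos),
    DirichletCharacter.changeLevel hdvd χ, ?_⟩
  intro n hn
  have hn0 : n ≠ 0 := by
    rintro rfl
    have : Nat.gcd 0 (q * (Q * M)) = q * (Q * M) := Nat.gcd_zero_left _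
    rw [Nat.Coprime] at hn
    have hge : 2 ≤ q * (Q * M) := le_trans hq (Nat.le_mul_of_pos_right _ (Nat.mul_pos hQ hMpos))
    omega
  -- f n = χ n
  have hprimes : ∀ p : ℕ, p.Prime → p ∣ n → f p = χ p := by
    intro p hp hpn
    have hpQM : Nat.Coprime p (q * (Q * M)) := Nat.Coprime.coprime_dvd_left hpn hn
    have hpQ : ¬ p ∣ Q :=
      (Nat.Prime.coprime_iff_not_dvd hp).mp (Nat.Coprime.coprime_dvd_right hdvd hpQM)
    have hpM : ¬ p ∣ M :=
      (Nat.Prime.coprime_iff_not_dvd hp).mp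
        (Nat.Coprime.coprime_dvd_right ⟨q * Q, by ring⟩ hpQM)
    rw [← hχ p hp hpQ, hgprime p hp, if_neg hpM]
  have hfχ : f n = χ n := by
    rw [cm_eq_prod_factorization hf h1 hn0]
    conv_rhs => rw [← Nat.prod_factorization_pow_eq_self hn0]
    rw [Finsupp.prod, Finsupp.prod, Nat.cast_prod, map_prod]
    refine Finset.prod_congr rfl (fun p hp => ?_)
    have hpp : p.Prime := Nat.prime_of_mem_primeFactors (by simpa using hp)
    have hpn : p ∣ n := Nat.dvd_of_mem_primeFactors (by simpa using hp)
    rw [Nat.cast_pow, map_pow, hprimes p hpp hpn]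
  rw [hfχ]
  -- χ n = changeLevel χ n for n coprime to the big modulus
  have hcopZ : IsCoprime (n : ℤ) ((q * (Q * M) : ℕ) : ℤ) :=
    Nat.isCoprime_iff_coprime.mpr hn
  have h := DirichletCharacter.changeLevel_eq_cast_of_dvd' χ hdvd hcopZ
  simp only [Int.cast_natCast] at h
  exact h.symm

/-- **Klurman–Kurlberg 2019, Theorem 1.3 from Elliott–Kish 2017, Theorem 2.** The complete
printed proof of Theorem 1.3, with its single deep input — Elliott–Kish's determination of the
completely multiplicative functions constant on the ratios `(an+1)/(An+1)` — as the explicit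
hypothesis `hEK` (special case `b = B = 1`, `c = 1`, unimodular `g`, existential modulus);
everything else
(Prop 2.4 = sparse half, the stripping/pigeonhole argument of Prop 2.1, the assembly) is proved
in this file. Discharging the named fact `KlurmanKurlberg2019_thm13` therefore reduces exactly
to vendoring/proving `hEK`. [cite: KlurmanKurlberg2019, Thm 1.3] -/
theorem KlurmanKurlberg2019_thm13_of_ElliottKish
    (hEK : ∀ a A : ℕ, 0 < a → 0 < A → a ≠ A → ∀ g : ℕ → ℂ,
      (∀ m n : ℕ, 1 ≤ m → 1 ≤ n → g (m * n) = g m * g n) → (∀ n : ℕ, 1 ≤ n → ‖g n‖ = 1) →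
      (∀ n : ℕ, 1 ≤ n → g (a * n + 1) = g (A * n + 1)) →
        ∃ Q : ℕ, 0 < Q ∧ ∃ χ : DirichletCharacter ℂ Q, ∀ p : ℕ, p.Prime → ¬ p ∣ Q → g p = χ p) :
    KlurmanKurlberg2019_thm13 :=
  KlurmanKurlberg2019_thm13_of_prop21
    (fun _ hq _ hf hA hfin => KlurmanKurlberg2019_prop21_of_ElliottKish hEK hq hf hA hfin)

end Dense




end Literature.NumberTheory.LFunctions
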